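import Summits.QuantumFields.YangMills.Theses.UnitScaleTilt
import Literature.MathematicalPhysics.QuantumFieldTheory.Balaban1983to89.T3BareTailProfile

/-!
# Route `UnitScaleTilt` — crux K2 `HistoryTail` (stmt-QuantumFields-18916) REDUCED TO THE BLOCK-AVERAGED HEIGHTS
# (support file; K2 itself stays open)

Cell `ym3-torus` (HUMAN RULING D-0037, YM ladder rung R3), seat `ym3-torus-p2` gen 4.  The tree reduces K2 to ONE per-height
large-field Gibbs tail `T3CruxEstimates.HeightTailAt` (p407887; support file `UnitScaleTiltHistoryTail`, p408722).  Gen 4 PROVES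
its finest-height (bare-plaquette) part, uniformly in the cutoff — Osterwalder–Seiler reflection positivity ⇒ the Fröhlich–Israel–
Lieb–Simon chessboard estimate on tori of every even side (`WilsonPlaquetteChessboardEvenSide`) ⇒ the single-plaquette tail
`μ{‖U_p − 1‖ ≥ θ} ≤ C(1+β)^{9/2}e^{−βθ²/2}` (`WilsonPlaquetteLargeFieldTail`, Laplace lower bound on `Z` with Haar small balls)
⇒ `Gibbs_K{¬PlaqSmall θ(K)} ≤ A·2^{−K}` (`T3BarePlaquetteTail`, `T3BareTailProfile.bareTailAt`) — so that
`HeightTailAt ↔ AveragedTailAt` (`T3BareTailProfile.heightTailAt_iff_averagedTailAt`).  Hence: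

`unitScaleTilt_historyTail_of_averagedTail`: K2 ⇐ for every `L` some profile `(b₀, p₀)` (`0 < b₀`, `2 < p₀`) and threshold
`0 < γ₁ ≤ 1` such that every family with `F.L = L` and `0 < γ ≤ γ₁` satisfies `AveragedTailAt F γ b₀ p₀` — a cutoff-uniform
large-field tail for the `j`-fold BLOCK-AVERAGED fields, `1 ≤ j ≤ K` (the relative weight of Bałaban's densities `ρ_j` on the
height-`j` large-field regions, [Balaban1985UV3] (41)/(71); the part that needs the renormalisation-group representation).
NOT a proof of K2.
-/

noncomputable section

open Literature.MathematicalPhysics.QuantumFieldTheory.Balaban1983to89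
open Literature.MathematicalPhysics.QuantumFieldTheory.Balaban1983to89.T3ContinuumYM3Torus
open Literature.MathematicalPhysics.QuantumFieldTheory.Balaban1983to89.T3UnitScaleTilt
open Literature.MathematicalPhysics.QuantumFieldTheory.Balaban1983to89.T3BareTailProfile
open Summit.QuantumFields.YangMills.Theses.UnitScaleTilt

namespace Summit.QuantumFields.YangMills.Theorems

/-- **K2 ⇐ THE AVERAGED HEIGHTS ALONE** (`T3BareTailProfile.AveragedTailAt` under the prefix `∀ L, ∃ profile, ∃ γ₁ ≤ 1,
∀ F γ ≤ γ₁`): the bare term is a theorem (`bareTailAt`), so a cutoff-uniform profile for the block-averaged heights `j ≥ 1`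
gives `HistoryTail` at EVERY free top fraction `1/m`. -/
theorem unitScaleTilt_historyTail_of_averagedTail
    (h : ∀ L : ℕ, ∃ b₀ p₀ γ₁ : ℝ, 0 < b₀ ∧ 2 < p₀ ∧ 0 < γ₁ ∧ γ₁ ≤ 1 ∧
      ∀ (F : T3Family) (γ : ℝ), F.L = L → 0 < γ → γ ≤ γ₁ → AveragedTailAt F γ b₀ p₀) :
    HistoryTail := by
  intro L m hm
  obtain ⟨b₀, p₀, γ₁, hb, hp, hγ₁, hγ₁1, h⟩ := h L
  exact ⟨b₀, p₀, γ₁, hb, hp, hγ₁, fun F γ hL hγ hle =>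
    historyTailAt_of_averagedTailAt F hγ (hle.trans hγ₁1) hb (by linarith) hm (h F γ hL hγ hle)⟩

/-- **The bare term of K2 is a theorem, in the route's quantifier shape**: for every `L`, every profile `0 < b₀`, `1 ≤ p₀`, with
`γ₁ = 1`, every family with `F.L = L` and `0 < γ ≤ 1` satisfies `BareTailAt F γ b₀ p₀`. -/
theorem unitScaleTilt_bareTail (L : ℕ) {b₀ p₀ : ℝ} (hb : 0 < b₀) (hp : 1 ≤ p₀) :
    ∀ (F : T3Family) (γ : ℝ), F.L = L → 0 < γ → γ ≤ 1 → BareTailAt F γ b₀ p₀ :=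
  fun F _γ _ hγ hle => bareTailAt F hγ hle hb hp

end Summit.QuantumFields.YangMills.Theorems

end
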